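import Literature.AlgebraicGeometry.Resolution.CurveConfigurationStrictTransform
import Literature.AlgebraicGeometry.Resolution.AlterationsCurves
import Literature.AlgebraicGeometry.Resolution.MonomialOrderReductionUnit
import HarnessLib

/-!
# Configurations of curves under the blowing up of a point, II: intersection multiplicities

Topic: `Literature/AlgebraicGeometry/Resolution`. Second of four files on the curve-configuration part of
steps 1–2 of Cossart–Piltant 2008, Prop. 4.4 (see `CurveConfigurationStrictTransform.lean` for the setting and
the currency). Here: the intersection multiplicity of two curves at a common point,
`m_p(C ∩ C') = ℓ_{𝒪_{X,p}}(𝒪_{X,p} ⧸ (𝓘_{C,p} + 𝓘_{C',p}))` (The Stacks Project, (54.15.2.1) = Tag 0BI6), in the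
currency of reduced closed sets:
* `length_quotient_ne_top_of_ne_bot`, `length_stalk_quotient_sup_ne_top` — `m_p(C ∩ C')` is FINITE whenever
  `C ⊄ C'`, without any regularity hypothesis (a Noetherian domain of dimension `≤ 1` modulo a non-zero ideal
  is Artinian, Stacks Tag 00KH; the tree's `length_stalk_quotient_ker_sup_ne_top` assumed the curve regular at
  `p`); `one_le_length_stalk_quotient_sup` (`m_p ≥ 1`); `length_stalk_quotient_sup_eq_one_iff` (transverse,
  `𝓘_{C,p} + 𝓘_{C',p} = 𝔪_p`, iff `m_p = 1`);
* `finite_inter_of_not_subset` — two curves `C ⊄ C'` meet in finitely many points;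
* `length_strictTransform_eq_of_ne` — off the exceptional fibre the multiplicities of the strict transforms are
  those of the curves (the blowing up is a local isomorphism there, Tag 02OS);
* `exists_strictTransform_inter_fibre_eq`, `exists_strictTransform_inter_fibre_eq_and_length_lt` — Stacks
  Lemma 54.15.3 = Tag 0BI7 (2), (3) (tree theorem `Stacks0BI7_core`) in this currency: the strict transform of a
  curve regular at the centre meets the exceptional fibre in one point, where its multiplicity with the strict
  transform of another curve through the centre is smaller than at the centre.

Kernel-checked assembly of tree results; no new definitions. AI-written; weaker than expert review. F-71 is
NOT discharged by this file; no summit statement is proved.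

## References
* The Stacks Project, Tags 0BI3, 0BI6, 0BI7, 0BIC, 00KH, 00IX, 02OS. [StacksProject]
* V. Cossart, O. Piltant, J. Algebra 320 (2008), Prop. 4.4 (proof, p. 10). [CossartPiltant2008]
-/

noncomputable section

open CategoryTheory AlgebraicGeometry TopologicalSpace IsLocalRing

universe u

namespace Literature.AlgebraicGeometry.Resolution

open Scheme.IdealSheafData

namespace CurveConfiguration

variable {X X' : Scheme.{u}} {π : X' ⟶ X} {x : X} {hx : IsClosed ({x} : Set X)}

/-! ## Intersection multiplicities `m_p(C ∩ C') = ℓ(𝒪_{X,p} ⧸ (𝓘_{C,p} + 𝓘_{C',p}))` (Stacks Tag 0BI6) -/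

section Algebra

/-- In a Noetherian domain of dimension `≤ 1` every non-zero ideal has a quotient of finite length (the
quotient is a Noetherian ring of dimension `0`, hence Artinian; Stacks, Algebra, Lemma 10.62.3 as used in
Tag 0BI3). [cite: StacksProject, Tag 0BI3 (§54.15, before Lemma 54.15.3)] -/
theorem length_quotient_ne_top_of_ne_bot {A : Type*} [CommRing A] [IsDomain A] [IsNoetherianRing A]
    (hA : ringKrullDim A ≤ 1) {J : Ideal A} (hJ : J ≠ ⊥) : Module.length A (A ⧸ J) ≠ ⊤ := by
  obtain ⟨r, hrJ, hr0⟩ := J.ne_bot_iff.mp hJ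
  have hr : r ∈ nonZeroDivisors A := mem_nonZeroDivisors_of_ne_zero hr0
  have h1 := ringKrullDim_quotient_succ_le_of_nonZeroDivisor hr
  have hle : Ideal.span {r} ≤ J := (Ideal.span_singleton_le_iff_mem _).mpr hrJ
  have h2 : ringKrullDim (A ⧸ J) ≤ ringKrullDim (A ⧸ Ideal.span {r}) :=
    ringKrullDim_le_of_surjective (Ideal.Quotient.factor hle) (Ideal.Quotient.factor_surjective hle)
  have h0' : ringKrullDim (A ⧸ Ideal.span {r}) ≤ 0 := by
    generalize hd : ringKrullDim (A ⧸ Ideal.span {r}) = d at h1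
    have h3 : d + 1 ≤ 1 := h1.trans hA
    induction d using WithBot.recBotCoe with
    | bot => exact bot_le
    | coe e =>
      have h4 : ((e + 1 : ℕ∞) : WithBot ℕ∞) ≤ ((1 : ℕ∞) : WithBot ℕ∞) := by exact_mod_cast h3
      have h5 : e + 1 ≤ 1 := WithBot.coe_le_coe.mp h4
      have he : e ≠ ⊤ := by
        rintro rfl
        exact absurd h5 (by decide)
      have h6 : e < 1 := (ENat.add_one_le_iff he).mp h5
      have h7 : e = 0 := Order.lt_one_iff.mp h6
      rw [h7]
      exact le_of_eq (by rfl)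
  haveI : Ring.KrullDimLE 0 (A ⧸ J) := Ring.krullDimLE_iff.mpr (h2.trans h0')
  haveI : IsArtinianRing (A ⧸ J) := isArtinianRing_iff_krullDimLE_zero.mpr inferInstance
  rw [Module.length_eq_of_surjective (S := A) (R := A ⧸ J) (M := A ⧸ J)
    (by rw [Ideal.Quotient.algebraMap_eq]; exact Ideal.Quotient.mk_surjective)]
  exact Module.length_ne_top

/-- In a local ring, `ℓ(A ⧸ I) = 1` iff `I` is the maximal ideal (the multiplicity-one case «`m_p(Y_i ∩ Y_j) = 1`» of Tag 0BIC). [cite: StacksProject, Tag 0BIC (Lemma 54.15.6, proof)] -/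
theorem length_quotient_eq_one_iff {A : Type*} [CommRing A] [IsLocalRing A] (I : Ideal A) :
    Module.length A (A ⧸ I) = 1 ↔ I = maximalIdeal A := by
  constructor
  · intro h
    have hs : IsSimpleModule A (A ⧸ I) := Module.length_eq_one_iff.mp h
    have hco : IsCoatom I := isSimpleModule_iff_isCoatom.mp hs
    exact IsLocalRing.eq_maximalIdeal (Ideal.isMaximal_def.mpr hco)
  · rintro rfl
    exact length_quotient_maximalIdeal

end Algebra

/-- **`m_p(C ∩ C')` is finite** for a point `p` of an integral one-dimensional `V(𝓘_C)` whose generic point is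
not on `C'` — with NO regularity hypothesis (Stacks Tag 0BI3: «`𝒪_{Y∩Z,p}` has support equal to `{𝔪_p}` …
Hence the length is finite»; compare `length_stalk_quotient_ker_sup_ne_top`, the regular case).
[cite: StacksProject, Tag 0BI3 (§54.15, before Lemma 54.15.3)] -/
theorem length_stalk_quotient_sup_ne_top (C C' : Closeds X) [IsIntegral (vanishingIdeal C).subscheme]
    [IsLocallyNoetherian (vanishingIdeal C).subscheme]
    (hdim : topologicalKrullDim (vanishingIdeal C).subscheme = 1)
    (c : (vanishingIdeal C).subscheme)
    (hη : (vanishingIdeal C).subschemeι (genericPoint (vanishingIdeal C).subscheme) ∉ (C' : Set X)) :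
    Module.length (X.presheaf.stalk ((vanishingIdeal C).subschemeι c))
      (X.presheaf.stalk ((vanishingIdeal C).subschemeι c) ⧸
        (stalkIdeal (vanishingIdeal C) ((vanishingIdeal C).subschemeι c) ⊔
          stalkIdeal (vanishingIdeal C') ((vanishingIdeal C).subschemeι c))) ≠ ⊤ := by
  rw [length_stalk_quotient_sup_eq_subscheme, stalkIdeal_comap_eq_map_stalkMap]
  have hη' : (vanishingIdeal C).subschemeι (genericPoint (vanishingIdeal C).subscheme) ∉
      ((vanishingIdeal C').support : Set X) := by rwa [coe_support_vanishingIdeal]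
  exact length_quotient_ne_top_of_ne_bot (ringKrullDim_stalk_le_one hdim.le c)
    (map_stalkMap_stalkIdeal_ne_bot (vanishingIdeal C).subschemeι (vanishingIdeal C') c hη')

/-- **`m_p(C ∩ C') ≥ 1`** at a common point. [cite: StacksProject, Tag 0BI3 (§54.15, before Lemma 54.15.3)] -/
theorem one_le_length_stalk_quotient_sup (C C' : Closeds X) {p : X} (hpC : p ∈ (C : Set X))
    (hpC' : p ∈ (C' : Set X)) :
    1 ≤ Module.length (X.presheaf.stalk p)
      (X.presheaf.stalk p ⧸ (stalkIdeal (vanishingIdeal C) p ⊔ stalkIdeal (vanishingIdeal C') p)) := by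
  obtain ⟨c, rfl⟩ := exists_subschemeι_eq C hpC
  have h := one_le_length_stalk_quotient_ker_sup (vanishingIdeal C).subschemeι (vanishingIdeal C') c
    (show (vanishingIdeal C).subschemeι c ∈ ((vanishingIdeal C').support : Set X) by
      rwa [coe_support_vanishingIdeal])
  rwa [ker_subschemeι] at h

/-- **Two curves are transverse at a common point iff they meet with multiplicity one**:
`𝓘_{C,p} + 𝓘_{C',p} = 𝔪_p ↔ m_p(C ∩ C') = 1`. [cite: StacksProject, Tag 0BIC (Lemma 54.15.6, proof)] -/
theorem length_stalk_quotient_sup_eq_one_iff (C C' : Closeds X) (p : X) :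
    Module.length (X.presheaf.stalk p)
      (X.presheaf.stalk p ⧸ (stalkIdeal (vanishingIdeal C) p ⊔ stalkIdeal (vanishingIdeal C') p)) = 1 ↔
    stalkIdeal (vanishingIdeal C) p ⊔ stalkIdeal (vanishingIdeal C') p = maximalIdeal (X.presheaf.stalk p) :=
  length_quotient_eq_one_iff _

/-- **Two distinct incomparable curves meet in finitely many points** (a proper closed subset of an
irreducible Noetherian one-dimensional sober space is finite; the points `p` of Tag 0BIC, proof ¶2). [cite: StacksProject, Tag 0BIC (Lemma 54.15.6, proof)] -/
theorem finite_inter_of_not_subset (C C' : Closeds X) [IsIntegral (vanishingIdeal C).subscheme]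
    [IsNoetherian (vanishingIdeal C).subscheme] (hdim : topologicalKrullDim (vanishingIdeal C).subscheme = 1)
    (hCC' : ¬ (C : Set X) ⊆ C') : ((C : Set X) ∩ C').Finite := by
  set ι := (vanishingIdeal C).subschemeι with hι
  have hZc : IsClosed (ι ⁻¹' (C' : Set X)) := C'.isClosed.preimage ι.continuous
  have hZne : ι ⁻¹' (C' : Set X) ≠ Set.univ := by
    intro h
    apply hCC'
    intro p hp
    obtain ⟨c, rfl⟩ := exists_subschemeι_eq C hp
    exact (h ▸ Set.mem_univ c : c ∈ ι ⁻¹' (C' : Set X))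
  have hfin := (Set.finite_and_isClosed_singleton_of_dim_le_one hdim.le hZc hZne).1
  have heq : (C : Set X) ∩ C' = ι '' (ι ⁻¹' (C' : Set X)) := by
    rw [Set.image_preimage_eq_inter_range, range_subschemeι, coe_support_vanishingIdeal, Set.inter_comm]
  rw [heq]
  exact hfin.image _

/-- The generic point of `V(𝓘_C)` lies on `C'` only if `C ⊆ C'`. [cite: StacksProject, Tag 0BI3 (§54.15, situation before Lemma 54.15.3)] -/
theorem subset_of_subschemeι_genericPoint_mem (C C' : Closeds X) [IsIntegral (vanishingIdeal C).subscheme]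
    (h : (vanishingIdeal C).subschemeι (genericPoint (vanishingIdeal C).subscheme) ∈ (C' : Set X)) :
    (C : Set X) ⊆ C' := by
  set ι := (vanishingIdeal C).subschemeι with hι
  intro p hp
  obtain ⟨c, rfl⟩ := exists_subschemeι_eq C hp
  have hc : c ∈ closure ({genericPoint (vanishingIdeal C).subscheme} : Set _) := by
    rw [(genericPoint_spec (vanishingIdeal C).subscheme).def]; trivial
  have himg : ι c ∈ closure ({ι (genericPoint (vanishingIdeal C).subscheme)} : Set X) := by
    have := (map_mem_closure ι.continuous hc (t := {ι (genericPoint (vanishingIdeal C).subscheme)})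
      (fun y hy => by rw [Set.mem_singleton_iff] at hy; rw [hy]; exact Set.mem_singleton _))
    exact this
  exact closure_minimal (Set.singleton_subset_iff.mpr h) C'.isClosed himg

/-! ## Off the exceptional fibre nothing changes -/

/-- Off the centre the stalk of a strict transform is the pushed-forward stalk: for `π q ∉ V(C₀)`,
`σᶜ(K)_q = K_{π q} · 𝒪_{X',q}`. [cite: StacksProject, Tag 02OS] -/
theorem stalkIdeal_strictTransformIdeal_of_notMem [IsLocallyNoetherian X'] (π : X' ⟶ X) (C₀ K : X.IdealSheafData)
    {q : X'} (hq : π q ∉ (C₀.support : Set X)) :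
    stalkIdeal (strictTransformIdeal π C₀ K) q = (stalkIdeal K (π q)).map (π.stalkMap q).hom := by
  rw [stalkIdeal_strictTransformIdeal]
  have hE : stalkIdeal (C₀.comap π) q = ⊤ := by
    by_contra hne
    have hq' : q ∈ ((C₀.comap π).support : Set X') :=
      (mem_support_iff_stalkIdeal_le _ _).mpr (IsLocalRing.le_maximalIdeal hne)
    rw [Scheme.IdealSheafData.support_comap] at hq'
    exact hq hq'
  have hcol : ∀ n : ℕ, Submodule.colon ((stalkIdeal K (π q)).map (π.stalkMap q).hom)
      ((stalkIdeal (C₀.comap π) q ^ n : Ideal _) : Set (X'.presheaf.stalk q)) =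
      (stalkIdeal K (π q)).map (π.stalkMap q).hom := by
    intro n
    rw [hE, Ideal.top_pow]  -- ⊤ ^ n = ⊤
    ext a
    rw [Submodule.mem_colon]
    constructor
    · intro h
      simpa using h 1 trivial
    · intro h s _
      rw [smul_eq_mul, mul_comm]
      exact Ideal.mul_mem_left _ s h
  simp_rw [hcol]
  exact ciSup_const

/-- **Off the exceptional fibre the intersection multiplicities of the strict transforms are those of the
curves**: for `π q ≠ x`, `m_q(C̃ ∩ C̃') = m_{π q}(C ∩ C')` (the blowing up is a local isomorphism there).
[cite: StacksProject, Tag 02OS] -/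
theorem length_strictTransform_eq_of_ne [IsLocallyNoetherian X] [IsLocallyNoetherian X']
    (hπ : IsBlowup π (vanishingIdeal ⟨{x}, hx⟩)) (C C' : Closeds X)
    [IsIntegral (vanishingIdeal C).subscheme] (hdimC : topologicalKrullDim (vanishingIdeal C).subscheme = 1)
    [IsIntegral (vanishingIdeal C').subscheme] (hdimC' : topologicalKrullDim (vanishingIdeal C').subscheme = 1)
    {q : X'} (hq : π q ≠ x) :
    Module.length (X'.presheaf.stalk q) (X'.presheaf.stalk q ⧸
      (stalkIdeal (vanishingIdeal ⟨closure (π ⁻¹' ((C : Set X) \ {x})), isClosed_closure⟩) q ⊔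
        stalkIdeal (vanishingIdeal ⟨closure (π ⁻¹' ((C' : Set X) \ {x})), isClosed_closure⟩) q)) =
    Module.length (X.presheaf.stalk (π q)) (X.presheaf.stalk (π q) ⧸
      (stalkIdeal (vanishingIdeal C) (π q) ⊔ stalkIdeal (vanishingIdeal C') (π q))) := by
  have hq' : π q ∉ ((vanishingIdeal ⟨{x}, hx⟩).support : Set X) := by
    rw [coe_support_vanishingIdeal]; exact hq
  rw [← strictTransformIdeal_vanishingIdeal_eq hπ C hdimC, ← strictTransformIdeal_vanishingIdeal_eq hπ C' hdimC',
    stalkIdeal_strictTransformIdeal_of_notMem π _ _ hq', stalkIdeal_strictTransformIdeal_of_notMem π _ _ hq',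
    ← Ideal.map_sup]
  haveI : IsIso (π.stalkMap q) := hπ.isIso_stalkMap_of_not_mem_support hq'
  have hbij := ConcreteCategory.bijective_of_isIso (π.stalkMap q)
  have hker : RingHom.ker (π.stalkMap q).hom = ⊥ := (RingHom.injective_iff_ker_eq_bot _).mp hbij.1
  have h := length_quotient_ker_sup_eq_of_surjective (π.stalkMap q).hom hbij.2
    (stalkIdeal (vanishingIdeal C) (π q) ⊔ stalkIdeal (vanishingIdeal C') (π q))
  rw [hker, bot_sup_eq] at h
  exact h.symm

/-! ## Over the centre: regular branches (Stacks Tag 0BI7) -/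

/-- **The strict transform of a curve regular at the centre `x ∈ C` meets the exceptional fibre in exactly one
point** (Stacks Tag 0BI7 (2), tree theorem `Stacks0BI7_core` with `Z` the centre itself).
[cite: StacksProject, Tag 0BI7 (Lemma 54.15.3 (2))] -/
theorem exists_strictTransform_inter_fibre_eq [IsLocallyNoetherian X] [IsLocallyNoetherian X']
    (hπ : IsBlowup π (vanishingIdeal ⟨{x}, hx⟩)) (C : Closeds X)
    [IsIntegral (vanishingIdeal C).subscheme] (hdimC : topologicalKrullDim (vanishingIdeal C).subscheme = 1)
    {c : (vanishingIdeal C).subscheme} (hc : (vanishingIdeal C).subschemeι c = x)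
    (hreg : IsRegularLocalRing ((vanishingIdeal C).subscheme.presheaf.stalk c)) :
    ∃ q₀ : X', closure (π ⁻¹' ((C : Set X) \ {x})) ∩ π ⁻¹' {x} = {q₀} := by
  set ι := (vanishingIdeal C).subschemeι with hι
  have hη : ι (genericPoint (vanishingIdeal C).subscheme) ∉ ((vanishingIdeal ⟨{x}, hx⟩).support : Set X) :=
    subschemeι_genericPoint_notMem_singleton C hdimC hx hc
  have hm : maximalIdeal ((vanishingIdeal C).subscheme.presheaf.stalk c) ≠ ⊥ := fun h =>
    not_isField_stalk_of_subschemeι_eq C hdimC hx hc ((IsLocalRing.isField_iff_maximalIdeal_eq).mpr h)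
  haveI : IsLocallyNoetherian (vanishingIdeal C).subscheme := LocallyOfFiniteType.isLocallyNoetherian ι
  have hCY : IsEffectiveCartier ((vanishingIdeal ⟨{x}, hx⟩).comap ι) :=
    isEffectiveCartier_comap_vanishingIdeal_singleton ι c hx hc hreg (ringKrullDim_stalk_le_one hdimC.le c) hm
  have hCy : stalkIdeal ((vanishingIdeal ⟨{x}, hx⟩).comap ι) c =
      maximalIdeal ((vanishingIdeal C).subscheme.presheaf.stalk c) :=
    stalkIdeal_comap_vanishingIdeal_singleton ι hx hc
  obtain ⟨q, h1, -, -⟩ := Stacks0BI7_core ι (vanishingIdeal ⟨{x}, hx⟩) (vanishingIdeal ⟨{x}, hx⟩) c hdimC hreg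
    hη le_rfl hCY hCy hπ
  rw [ker_subschemeι, hc, strictTransformIdeal_vanishingIdeal_eq hπ C hdimC, coe_support_vanishingIdeal] at h1
  exact ⟨q, h1⟩

/-- **The strict transform of a curve regular at the centre `x ∈ C` meets the exceptional fibre in exactly one
point, where its intersection multiplicity with the strict transform of any other curve `C' ∋ x` is smaller than
`m_x(C ∩ C')`** (Stacks Lemma 54.15.3 = Tag 0BI7 (2), (3), tree theorem `Stacks0BI7_core`, in the currency of
reduced closed sets and topological strict transforms). [cite: StacksProject, Tag 0BI7 (Lemma 54.15.3 (2), (3))] -/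
theorem exists_strictTransform_inter_fibre_eq_and_length_lt [IsLocallyNoetherian X] [IsLocallyNoetherian X']
    (hπ : IsBlowup π (vanishingIdeal ⟨{x}, hx⟩)) (C C' : Closeds X)
    [IsIntegral (vanishingIdeal C).subscheme] (hdimC : topologicalKrullDim (vanishingIdeal C).subscheme = 1)
    [IsIntegral (vanishingIdeal C').subscheme] (hdimC' : topologicalKrullDim (vanishingIdeal C').subscheme = 1)
    (hxC' : x ∈ (C' : Set X)) (hCC' : ¬ (C : Set X) ⊆ C')
    {c : (vanishingIdeal C).subscheme} (hc : (vanishingIdeal C).subschemeι c = x)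
    (hreg : IsRegularLocalRing ((vanishingIdeal C).subscheme.presheaf.stalk c)) :
    ∃ q₀ : X', closure (π ⁻¹' ((C : Set X) \ {x})) ∩ π ⁻¹' {x} = {q₀} ∧
      Module.length (X'.presheaf.stalk q₀) (X'.presheaf.stalk q₀ ⧸
        (stalkIdeal (vanishingIdeal ⟨closure (π ⁻¹' ((C : Set X) \ {x})), isClosed_closure⟩) q₀ ⊔
          stalkIdeal (vanishingIdeal ⟨closure (π ⁻¹' ((C' : Set X) \ {x})), isClosed_closure⟩) q₀)) <
      Module.length (X.presheaf.stalk x) (X.presheaf.stalk x ⧸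
        (stalkIdeal (vanishingIdeal C) x ⊔ stalkIdeal (vanishingIdeal C') x)) := by
  set ι := (vanishingIdeal C).subschemeι with hι
  have hη : ι (genericPoint (vanishingIdeal C).subscheme) ∉ ((vanishingIdeal C').support : Set X) := by
    rw [coe_support_vanishingIdeal]
    exact fun h => hCC' (subset_of_subschemeι_genericPoint_mem C C' h)
  have hJC : vanishingIdeal C' ≤ vanishingIdeal ⟨{x}, hx⟩ :=
    le_support_iff_le_vanishingIdeal.mp (fun z hz => by
      have hz' : z = x := hz
      rw [hz']
      show x ∈ ((vanishingIdeal C').support : Set X)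
      rw [coe_support_vanishingIdeal]; exact hxC')
  have hm : maximalIdeal ((vanishingIdeal C).subscheme.presheaf.stalk c) ≠ ⊥ := fun h =>
    not_isField_stalk_of_subschemeι_eq C hdimC hx hc ((IsLocalRing.isField_iff_maximalIdeal_eq).mpr h)
  haveI : IsLocallyNoetherian (vanishingIdeal C).subscheme := LocallyOfFiniteType.isLocallyNoetherian ι
  have hCY : IsEffectiveCartier ((vanishingIdeal ⟨{x}, hx⟩).comap ι) :=
    isEffectiveCartier_comap_vanishingIdeal_singleton ι c hx hc hreg (ringKrullDim_stalk_le_one hdimC.le c) hm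
  have hCy : stalkIdeal ((vanishingIdeal ⟨{x}, hx⟩).comap ι) c =
      maximalIdeal ((vanishingIdeal C).subscheme.presheaf.stalk c) :=
    stalkIdeal_comap_vanishingIdeal_singleton ι hx hc
  obtain ⟨q, h1, -, h3⟩ := Stacks0BI7_core ι (vanishingIdeal C') (vanishingIdeal ⟨{x}, hx⟩) c hdimC hreg hη
    hJC hCY hCy hπ
  rw [ker_subschemeι, hc] at h1 h3
  rw [strictTransformIdeal_vanishingIdeal_eq hπ C hdimC] at h1 h3
  rw [strictTransformIdeal_vanishingIdeal_eq hπ C' hdimC'] at h3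
  refine ⟨q, ?_, h3⟩
  rw [coe_support_vanishingIdeal] at h1
  exact h1

end CurveConfiguration

end Literature.AlgebraicGeometry.Resolution

end
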